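import Mathlib
import Summits.Ventures.HodgeRepro2.Tier7.Line3.DivisorBound

/-!
# Tier7/Line3/SplitFactorProduct — the split places as a `finprod` of box counts bounded by the divisor bound
(seat t7-x1, gen 4; the third per-place kind of the product row, in the abstract)

LINE 3 (t7-plan-3), version (ii). At the SPLIT places the local factor of the geometric side is a BOX COUNT (SplitOrbitBox
p670387: the value pairs of the torus translates lie in a box of the discrete valuation, of size `(1 + e₁)(1 + e₂)`), it is
`1` at all but finitely many places FOR EACH `γ`, and the product over ALL split places is bounded by the divisor bound
(DivisorBound p672115: `∏ᶠ_𝔭 (1 + ord_𝔭 I) ≤ C · N(I)^ε`) — the global growth exponent `d′ = ε` of the dominance bookkeeping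
(census §C (g2)). This module types that product in the abstract, with the per-place count and the two ideals displayed:

* `finprod_le_finprod_of_le`: monotonicity of `∏ᶠ` for non-negative real families with finite multiplicative support;
* `mulSupport_one_add_multiplicity_finite`: `w ↦ 1 + ord_w I` has finite support for `I ≠ ⊥` (`Ideal.finite_factors`);
* `splitFactor b γ := ∏ᶠ w, (b w γ : ℝ)` for per-place counts `b w γ : ℕ`; `one_le_splitFactor` (every factor `≥ 1` at
  `γ₀` ⇒ the product is `≥ 1`, in particular `≠ 0`); `exists_splitFactor_le`: if `b w γ ≤ (1 + ord_w (I γ)) (1 + ord_w (J γ))`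
  for two non-zero ideals `I γ, J γ` of `𝓞 K` (the box's two side lengths as multiplicities of the «denominator ideals» of
  the double-coset invariant — SplitOrbitBox's `ord hi − ord lo + 1`), then `∏ᶠ_w b w γ ≤ C² · (N(I γ) · N(J γ))^ε` with ONE
  constant `C` for all `γ` (DivisorBound applied twice, `finprod_mul_distrib`);
* `splitFactor_clauses`: the three per-place-KIND clauses of LocalFactorProduct for the split product, with
  `size γ := N(I γ) · N(J γ)`: support vacuous, bound `‖splitFactor γ‖ ≤ C² (1 + size γ)^ε ‖splitFactor γ₀‖`, non-vanishing
  at `γ₀`.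

WHAT STAYS IN WORDS (the dictionary, as for every row of this seat): that the per-place count `b w γ` IS the box count of
SplitOrbitBox at `w` (the local factor of the split place for the test function `1_{K_w}`), that its two side lengths are
`1 + ord_w` of the two ideals `I γ, J γ` generated by the entries / determinant of the adapted representative of `γ`
(STATUS l. 15010 (1)–(2)), and the identification of `N(I γ) N(J γ)` with the dominance `size` (the product formula
ProductFormulaSeparation p666471 links the ideal norms of κ(γ)'s denominator to its archimedean size — a further row, not
this one). Nothing here is about (N), (P), the real `X`, or HC_CM; §8(d): NO. Blind lane: Mathlib + the HodgeRepro2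
prefix; no sorry; axioms ⊆ {propext, Classical.choice, Quot.sound}.
-/

namespace Summit.Ventures.HodgeRepro2.Tier7.Line3.SplitFactorProduct

open IsDedekindDomain IsDedekindDomain.HeightOneSpectrum NumberField Function
  Summit.Ventures.HodgeRepro2.Tier7.Line3.DivisorBound
open scoped NumberField BigOperators

/-! ## Monotonicity of `finprod` for non-negative real families -/

/-- `∏ᶠ f ≤ ∏ᶠ g` for `0 ≤ f ≤ g` with finite multiplicative supports. -/
theorem finprod_le_finprod_of_le {ι : Type*} (f g : ι → ℝ) (hf : (mulSupport f).Finite) (hg : (mulSupport g).Finite)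
    (h0 : ∀ i, 0 ≤ f i) (hfg : ∀ i, f i ≤ g i) : ∏ᶠ i, f i ≤ ∏ᶠ i, g i := by
  classical
  have hs : mulSupport f ⊆ (hf.union hg).toFinset := fun i hi => by
    rw [Set.Finite.coe_toFinset]; exact Set.mem_union_left _ hi
  have hs' : mulSupport g ⊆ (hf.union hg).toFinset := fun i hi => by
    rw [Set.Finite.coe_toFinset]; exact Set.mem_union_right _ hi
  rw [finprod_eq_prod_of_mulSupport_subset f hs, finprod_eq_prod_of_mulSupport_subset g hs']
  exact Finset.prod_le_prod (fun i _ => h0 i) (fun i _ => hfg i)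

/-- a `finprod` of real factors `≥ 1` (with finite support) is `≥ 1`. -/
theorem one_le_finprod_of_one_le {ι : Type*} (f : ι → ℝ) (hf : (mulSupport f).Finite) (h1 : ∀ i, 1 ≤ f i) :
    1 ≤ ∏ᶠ i, f i := by
  classical
  rw [finprod_eq_prod_of_mulSupport_subset f (s := hf.toFinset) (by rw [Set.Finite.coe_toFinset])]
  calc (1 : ℝ) = ∏ i ∈ hf.toFinset, (1 : ℝ) := by simp
    _ ≤ ∏ i ∈ hf.toFinset, f i := Finset.prod_le_prod (fun i _ => zero_le_one) (fun i _ => h1 i)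

/-! ## The divisor-bound family has finite support -/

variable {K : Type*} [Field K] [NumberField K]

/-- `w ↦ 1 + ord_w I` has finite multiplicative support for a non-zero ideal `I`. -/
theorem mulSupport_one_add_multiplicity_finite (I : Ideal (𝓞 K)) (hI : I ≠ ⊥) :
    (mulSupport fun w : HeightOneSpectrum (𝓞 K) => (1 + (multiplicity w.asIdeal I : ℝ))).Finite := by
  apply (Ideal.finite_factors hI).subset
  intro w hw
  rw [mem_mulSupport] at hw
  have hm : multiplicity w.asIdeal I ≠ 0 := by
    intro h0
    apply hw
    rw [h0, Nat.cast_zero, add_zero]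
  exact dvd_of_multiplicity_pos (Nat.pos_of_ne_zero hm)

/-! ## The split product -/

variable {Orb : Type*} (b : HeightOneSpectrum (𝓞 K) → Orb → ℕ)

/-- the product of the per-place counts over all (split) places. -/
noncomputable def splitFactor (γ : Orb) : ℝ := ∏ᶠ w, (b w γ : ℝ)

omit [NumberField K] in
/-- **non-vanishing**: every factor `≥ 1` at `γ₀` ⇒ the product is `≥ 1`. -/
theorem one_le_splitFactor (γ₀ : Orb) (hfin : (mulSupport fun w => (b w γ₀ : ℝ)).Finite) (h1 : ∀ w, 1 ≤ b w γ₀) :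
    1 ≤ splitFactor b γ₀ :=
  one_le_finprod_of_one_le _ hfin fun w => by exact_mod_cast h1 w

omit [NumberField K] in
/-- the product is non-zero at `γ₀`. -/
theorem splitFactor_γ₀_ne_zero (γ₀ : Orb) (hfin : (mulSupport fun w => (b w γ₀ : ℝ)).Finite)
    (h1 : ∀ w, 1 ≤ b w γ₀) : splitFactor b γ₀ ≠ 0 :=
  (zero_lt_one.trans_le (one_le_splitFactor b γ₀ hfin h1)).ne'

variable (I J : Orb → Ideal (𝓞 K))

/-- **the divisor bound for the split product**: per-place counts bounded by the box sizes `(1 + ord_w (I γ)) (1 + ord_w (J γ))`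
⇒ the product over all places is `≤ C² · (N(I γ) · N(J γ))^ε`, with one constant for all `γ`. -/
theorem exists_splitFactor_le {ε : ℝ} (hε : 0 < ε) (hI : ∀ γ, I γ ≠ ⊥) (hJ : ∀ γ, J γ ≠ ⊥)
    (hfin : ∀ γ, (mulSupport fun w => (b w γ : ℝ)).Finite)
    (hb : ∀ w γ, (b w γ : ℝ) ≤ (1 + (multiplicity w.asIdeal (I γ) : ℝ)) * (1 + (multiplicity w.asIdeal (J γ) : ℝ))) :
    ∃ C : ℝ, 0 < C ∧ ∀ γ, splitFactor b γ ≤ C * ((Ideal.absNorm (I γ) : ℝ) * Ideal.absNorm (J γ)) ^ ε := by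
  obtain ⟨C, hC, hdiv⟩ := exists_const_finprod_one_add_multiplicity_le_ringOfIntegers K hε
  refine ⟨C * C, mul_pos hC hC, fun γ => ?_⟩
  set fI : HeightOneSpectrum (𝓞 K) → ℝ := fun w => 1 + (multiplicity w.asIdeal (I γ) : ℝ) with hfI_def
  set fJ : HeightOneSpectrum (𝓞 K) → ℝ := fun w => 1 + (multiplicity w.asIdeal (J γ) : ℝ) with hfJ_def
  have hfI : (mulSupport fI).Finite := mulSupport_one_add_multiplicity_finite (I γ) (hI γ)
  have hfJ : (mulSupport fJ).Finite := mulSupport_one_add_multiplicity_finite (J γ) (hJ γ)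
  have hprod : (mulSupport fun w => fI w * fJ w).Finite := (hfI.union hfJ).subset (mulSupport_mul fI fJ)
  have h1 : splitFactor b γ ≤ ∏ᶠ w, fI w * fJ w :=
    finprod_le_finprod_of_le _ _ (hfin γ) hprod (fun w => Nat.cast_nonneg _) (fun w => hb w γ)
  have h2 : ∏ᶠ w, fI w * fJ w = (∏ᶠ w, fI w) * ∏ᶠ w, fJ w := finprod_mul_distrib hfI hfJ
  have h3 : ∏ᶠ w, fI w ≤ C * (Ideal.absNorm (I γ) : ℝ) ^ ε := hdiv _ (hI γ)
  have h4 : ∏ᶠ w, fJ w ≤ C * (Ideal.absNorm (J γ) : ℝ) ^ ε := hdiv _ (hJ γ)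
  have h5 : 0 ≤ ∏ᶠ w, fJ w := finprod_nonneg fun w => by
    simp only [hfJ_def]; positivity
  have h6 : 0 ≤ C * (Ideal.absNorm (I γ) : ℝ) ^ ε := by positivity
  have h7 : (C * (Ideal.absNorm (I γ) : ℝ) ^ ε) * (C * (Ideal.absNorm (J γ) : ℝ) ^ ε)
      = C * C * ((Ideal.absNorm (I γ) : ℝ) * Ideal.absNorm (J γ)) ^ ε := by
    rw [Real.mul_rpow (Nat.cast_nonneg _) (Nat.cast_nonneg _)]
    ring
  calc splitFactor b γ ≤ ∏ᶠ w, fI w * fJ w := h1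
    _ = (∏ᶠ w, fI w) * ∏ᶠ w, fJ w := h2
    _ ≤ (C * (Ideal.absNorm (I γ) : ℝ) ^ ε) * (C * (Ideal.absNorm (J γ) : ℝ) ^ ε) := mul_le_mul h3 h4 h5 h6
    _ = C * C * ((Ideal.absNorm (I γ) : ℝ) * Ideal.absNorm (J γ)) ^ ε := h7

/-- **the three clauses of the split product** in LocalFactorProduct's per-place-kind shape, with
`size γ := N(I γ) · N(J γ)`: support vacuous, bound `‖splitFactor γ‖ ≤ C² (1 + size γ)^ε ‖splitFactor γ₀‖`, non-vanishing
at `γ₀`. -/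
theorem splitFactor_clauses {ε : ℝ} (hε : 0 < ε) (hI : ∀ γ, I γ ≠ ⊥) (hJ : ∀ γ, J γ ≠ ⊥)
    (hfin : ∀ γ, (mulSupport fun w => (b w γ : ℝ)).Finite)
    (hb : ∀ w γ, (b w γ : ℝ) ≤ (1 + (multiplicity w.asIdeal (I γ) : ℝ)) * (1 + (multiplicity w.asIdeal (J γ) : ℝ)))
    (γ₀ : Orb) (h1 : ∀ w, 1 ≤ b w γ₀) :
    ∃ C : ℝ, 0 < C ∧
      (∀ γ, ((splitFactor b γ : ℝ) : ℂ) ≠ 0 → True) ∧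
      (∀ γ, True → ‖((splitFactor b γ : ℝ) : ℂ)‖ ≤
        C * (1 + (Ideal.absNorm (I γ) : ℝ) * Ideal.absNorm (J γ)) ^ ε * ‖((splitFactor b γ₀ : ℝ) : ℂ)‖) ∧
      ((splitFactor b γ₀ : ℝ) : ℂ) ≠ 0 := by
  obtain ⟨C, hC, hle⟩ := exists_splitFactor_le b I J hε hI hJ hfin hb
  have h1' := one_le_splitFactor b γ₀ (hfin γ₀) h1
  refine ⟨C, hC, fun _ _ => trivial, fun γ _ => ?_, ?_⟩
  · have hγ0 : 0 ≤ splitFactor b γ := finprod_nonneg fun w => Nat.cast_nonneg _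
    have hN : (0 : ℝ) ≤ (Ideal.absNorm (I γ) : ℝ) * Ideal.absNorm (J γ) := by positivity
    rw [Complex.norm_real, Complex.norm_real, Real.norm_of_nonneg hγ0, Real.norm_of_nonneg (zero_le_one.trans h1')]
    calc splitFactor b γ ≤ C * ((Ideal.absNorm (I γ) : ℝ) * Ideal.absNorm (J γ)) ^ ε := hle γ
      _ ≤ C * (1 + (Ideal.absNorm (I γ) : ℝ) * Ideal.absNorm (J γ)) ^ ε := by
          gcongr
          linarith
      _ ≤ C * (1 + (Ideal.absNorm (I γ) : ℝ) * Ideal.absNorm (J γ)) ^ ε * splitFactor b γ₀ := by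
          have hpos : 0 ≤ C * (1 + (Ideal.absNorm (I γ) : ℝ) * Ideal.absNorm (J γ)) ^ ε := by positivity
          calc C * (1 + (Ideal.absNorm (I γ) : ℝ) * Ideal.absNorm (J γ)) ^ ε
              = C * (1 + (Ideal.absNorm (I γ) : ℝ) * Ideal.absNorm (J γ)) ^ ε * 1 := (mul_one _).symm
            _ ≤ C * (1 + (Ideal.absNorm (I γ) : ℝ) * Ideal.absNorm (J γ)) ^ ε * splitFactor b γ₀ :=
                mul_le_mul_of_nonneg_left h1' hpos
  · exact_mod_cast splitFactor_γ₀_ne_zero b γ₀ (hfin γ₀) h1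

end Summit.Ventures.HodgeRepro2.Tier7.Line3.SplitFactorProduct
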